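import Summits.BirchSwinnertonDyer.BirchSwinnertonDyer.Theses.UniversalToricDescent
import HarnessLib

/-!
# Route UniversalToricDescent — closer of the glue 27174 `TwinWanFrameAtThreeNonOrdBucketsTOfSplit`
# (`TwinWanFrameAtThreeMultT → TwinWanFrameAtThreeGoodSSApZeroT → TwinWanFrameAtThreeNonOrdBucketsT`)

Prover bsd-wall-utd-p2 g12 (`--workitem stmt-BirchSwinnertonDyer-27174`; pen pss3x g4's act-T split (rev 48) of the
torsion-conditional twin package 27156 `TwinWanFrameAtThreeNonOrdBucketsT` into ♭B_T = 27172 and ♭C₀_T = 27173; the package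
is the verbatim conjunction of the two children). `And.intro`. THEOREM ONLY; BSD is not advanced by this file.
-/

set_option autoImplicit false
-- `…BirchSwinnertonDyer.BirchSwinnertonDyer.Theorems…` is the problem's mandated namespace (D-0017).
set_option linter.dupNamespace false

namespace Summit.BirchSwinnertonDyer.BirchSwinnertonDyer.Theorems

/-- **Item 27174 holds** (glue: `♭B_T → ♭C₀_T → ♭B_T ∧ ♭C₀_T`). [folklore] -/
theorem twinWanFrameAtThreeNonOrdBucketsTOfSplit_proof :
    Summit.BirchSwinnertonDyer.BirchSwinnertonDyer.Theses.UniversalToricDescent.TwinWanFrameAtThreeNonOrdBucketsTOfSplit :=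
  fun a b => ⟨a, b⟩

end Summit.BirchSwinnertonDyer.BirchSwinnertonDyer.Theorems
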